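import Literature.Topology.FourManifolds.RailCurve
import HarnessLib

/-!
# Rebuilding a band sum with explicit arches, IV: the neck

Topic `Literature/Topology/FourManifolds` (trunk T-4MAN). Fact seat
`provefact-Literature.Topology.FourManifolds.Knot.IsConnectedSum.isIsotopic` (Schubert's theorem).
First stage of the proof of the geometric heart for rail knots (`RailCurve.lean`): the two rails
of the rail knot `b.railKnot hAB` cross the middle line `x₀ = 1/2` of the band (along which the band
meets the separating sphere) at the heights `1/4` and `3/4`, at the *crossing parameters*
`b.tcLo = (alo + tlo)/2` and `b.tcHi = (thi + ahi)/2` (`railLo_tcLo`, `railUp_tcHi`: the first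
coordinate of a smooth step at the midpoint of its window is `1/2`, `smoothStep_midpoint`). The
later stages work at a small scale around one point of the middle line and need the two crossings
close together: this file moves them to the heights `1/2 - w` and `1/2 + w` for any `0 < w ≤ 1/4`,
by an isotopy.

* `Literature.Topology.FourManifolds.neckBump c r` — a smooth bump, `1` on `[c - r, c + r]`, `0`
  off `(c - 2r, c + 2r)`, with values in `[0, 1]`.
* `b.neckLo w u`, `b.neckUp w u` — the rail arches with the height on the window of half-width
  `epsLo/8` (resp. `epsHi/8`) about the crossing parameter raised by `u (1/4 - w)` (resp. lowered),
  blended back by the bump over the window of half-width `epsLo/4`; for `u = 0` they are the rail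
  arches, off the windows they agree with them for every `u`.
* `b.neckPiece w u`, `b.neckLoop w u = periodise alo (neckPiece w u)`, and for `u = 1` the
  **necked rail knot** `b.neckKnot w hAB` (`IsRegularLoop.toKnot`).
* `b.isIsotopic_railKnot_neckKnot` — **the rail knot is isotopic to the necked rail knot**: the
  family `u ↦ neckPiece w u` is a smooth modification of the rail piece function on the two closed
  windows, unit, regular and injective there (the first coordinate is still the strictly monotone
  smooth step, the heights stay below `1/2` resp. above `1/2`) and avoiding the rest of the knot,
  so `IsRegularLoop.isIsotopic_of_modification` (`CurveFamilyIsotopy.lean`, isotopy extension)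
  applies.
* The neck: `neckLo_of_mem_core` / `neckUp_of_mem_core` — on the core windows the necked arches
  are `(χ₁ t, 1/2 - w)` and `(χ t, 1/2 + w)`, crossing `x₀ = 1/2` at `tcLo`, `tcHi`.

Everything is proved; no named facts are introduced.

## References

Standard; all statements `[folklore]` (band sums: R. E. Gompf, A. I. Stipsicz, *4-Manifolds and
Kirby Calculus* (1999), §5.1; isotopy extension: M. W. Hirsch, *Differential Topology* (1976),
Ch. 8 §1, Thm. 1.3).
-/

open scoped Manifold ContDiff Topology Real
open Function Set Metric Filter

noncomputable section

namespace Literature.Topology.FourManifolds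

/-- Local notation: `𝔼 n` is the model Euclidean space `EuclideanSpace ℝ (Fin n)`. -/
local notation "𝔼 " n:arg => EuclideanSpace ℝ (Fin n)

/-- Local notation: `𝕊 n` is the unit sphere in `EuclideanSpace ℝ (Fin (n + 1))`. -/
local notation "𝕊 " n:arg => (Metric.sphere (0 : EuclideanSpace ℝ (Fin (n + 1))) 1)

/-! ### Symmetry of the smooth step; a smooth bump -/

/-- `smoothTransition x + smoothTransition (1 - x) = 1`. [folklore] -/
theorem smoothTransition_add_smoothTransition_one_sub (x : ℝ) :
    Real.smoothTransition x + Real.smoothTransition (1 - x) = 1 := by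
  have h1 := Real.smoothTransition.pos_denom x
  simp only [Real.smoothTransition, sub_sub_cancel]
  rw [add_comm (expNegInvGlue (1 - x)) (expNegInvGlue x)]
  field_simp

/-- **Symmetry of the smooth step** about the midpoint of its window. [folklore] -/
theorem smoothStep_symm {a b : ℝ} (hab : a < b) (x : ℝ) : smoothStep a b (a + b - x) = 1 - smoothStep a b x := by
  have h := smoothTransition_add_smoothTransition_one_sub ((x - a) / (b - a))
  have e : 1 - (x - a) / (b - a) = (a + b - x - a) / (b - a) := by
    field_simp [(sub_pos.2 hab).ne']
    ring
  simp only [smoothStep]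
  rw [← e]
  linarith

/-- **The smooth step at the midpoint of its window is `1/2`.** [folklore] -/
theorem smoothStep_midpoint {a b : ℝ} (hab : a < b) : smoothStep a b ((a + b) / 2) = 1 / 2 := by
  have h := smoothStep_symm hab ((a + b) / 2)
  rw [show a + b - (a + b) / 2 = (a + b) / 2 by ring] at h
  linarith

/-- **A smooth bump**: `1` on `[c - r, c + r]`, `0` off `(c - 2r, c + 2r)`. [folklore] -/
def neckBump (c r t : ℝ) : ℝ :=
  smoothStep (c - 2 * r) (c - r) t * (1 - smoothStep (c + r) (c + 2 * r) t)

/-- The bump is `C^∞`. [folklore] -/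
theorem contDiff_neckBump (c r : ℝ) : ContDiff ℝ ∞ (neckBump c r) :=
  (contDiff_smoothStep _ _).mul (contDiff_const.sub (contDiff_smoothStep _ _))

/-- The bump takes values in `[0, 1]`. [folklore] -/
theorem neckBump_mem_Icc (c r t : ℝ) : neckBump c r t ∈ Icc (0 : ℝ) 1 := by
  have h1 := smoothStep_mem_Icc (c - 2 * r) (c - r) t
  have h2 := smoothStep_mem_Icc (c + r) (c + 2 * r) t
  refine ⟨mul_nonneg h1.1 (by linarith [h2.2]), ?_⟩
  calc neckBump c r t ≤ 1 * 1 := mul_le_mul h1.2 (by linarith [h2.1]) (by linarith [h2.2]) zero_le_one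
    _ = 1 := one_mul 1

/-- The bump is `1` on the core `[c - r, c + r]`. [folklore] -/
theorem neckBump_eq_one {c r t : ℝ} (hr : 0 < r) (ht : t ∈ Icc (c - r) (c + r)) : neckBump c r t = 1 := by
  rw [neckBump, smoothStep_of_ge (by linarith) ht.1, smoothStep_of_le (by linarith) ht.2]; ring

/-- The bump vanishes left of `c - 2r`. [folklore] -/
theorem neckBump_eq_zero_of_le {c r t : ℝ} (hr : 0 < r) (ht : t ≤ c - 2 * r) : neckBump c r t = 0 := by
  rw [neckBump, smoothStep_of_le (by linarith) ht]; ring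

/-- The bump vanishes right of `c + 2r`. [folklore] -/
theorem neckBump_eq_zero_of_ge {c r t : ℝ} (hr : 0 < r) (ht : c + 2 * r ≤ t) : neckBump c r t = 0 := by
  rw [neckBump, smoothStep_of_ge (by linarith) ht]; ring

/-- The bump vanishes off the open window `(c - 2r, c + 2r)`. [folklore] -/
theorem neckBump_eq_zero_of_not_mem {c r t : ℝ} (hr : 0 < r) (ht : t ∉ Ioo (c - 2 * r) (c + 2 * r)) :
    neckBump c r t = 0 := by
  rcases le_or_gt t (c - 2 * r) with h | h
  · exact neckBump_eq_zero_of_le hr h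
  · exact neckBump_eq_zero_of_ge hr (not_lt.1 fun h' ↦ ht ⟨h, h'⟩)

namespace BandData

variable {A B K : Knot} {avoid : Set (𝕊 3)} (b : BandData A B K avoid)

/-! ### The crossing parameters -/

/-- The **lower crossing parameter**: the midpoint of the window of the lower rail arch. [folklore] -/
def tcLo : ℝ := (b.alo + b.tlo) / 2

/-- The **upper crossing parameter**: the midpoint of the window of the upper rail arch. [folklore] -/
def tcHi : ℝ := (b.thi + b.ahi) / 2

/-- The lower core and windows fit into the plateau:
`alo + 2 epsLo ≤ tcLo - epsLo/2 < tcLo + epsLo/2 ≤ tlo - 2 epsLo`. [folklore] -/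
theorem tcLo_window : b.alo + 2 * b.epsLo ≤ b.tcLo - b.epsLo / 2 ∧ b.tcLo + b.epsLo / 2 ≤ b.tlo - 2 * b.epsLo ∧
    0 < b.epsLo := by
  obtain ⟨hε, hε1, -⟩ := b.epsLo_bounds
  refine ⟨?_, ?_, hε⟩ <;> rw [tcLo] <;> linarith

/-- The upper core and windows fit into the plateau. [folklore] -/
theorem tcHi_window : b.thi + 2 * b.epsHi ≤ b.tcHi - b.epsHi / 2 ∧ b.tcHi + b.epsHi / 2 ≤ b.ahi - 2 * b.epsHi ∧
    0 < b.epsHi := by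
  obtain ⟨hε, hε1, -⟩ := b.epsHi_bounds
  refine ⟨?_, ?_, hε⟩ <;> rw [tcHi] <;> linarith

/-- **The lower rail crosses the middle line at `tcLo`**: `railLo tcLo = (1/2, 1/4)`. [folklore] -/
theorem railLo_tcLo : b.railLo b.tcLo = pt2 (1 / 2) (1 / 4) := by
  obtain ⟨h1, h2, hε⟩ := b.tcLo_window
  rw [b.railLo_of_mem_plateau ⟨by linarith, by linarith⟩, tcLo,
    show (b.alo + b.tlo) / 2 = (b.alo + b.epsLo + (b.tlo - b.epsLo)) / 2 by ring,
    smoothStep_midpoint (by linarith [b.cLo_hyp.2.1])]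

/-- **The upper rail crosses the middle line at `tcHi`**: `railUp tcHi = (1/2, 3/4)`. [folklore] -/
theorem railUp_tcHi : b.railUp b.tcHi = pt2 (1 / 2) (3 / 4) := by
  obtain ⟨h1, h2, hε⟩ := b.tcHi_window
  rw [b.railUp_of_mem_plateau ⟨by linarith, by linarith⟩, tcHi,
    show -((b.thi + b.ahi) / 2) = (-b.ahi + b.epsHi + (-b.thi - b.epsHi)) / 2 by ring,
    smoothStep_midpoint (by linarith [b.cUp_hyp.2.1])]

/-! ### The necked arches -/

/-- **The necked lower arch**: the height of the lower rail arch raised by `u (1/4 - w)` times the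
bump of core half-width `epsLo/8` about `tcLo`. [folklore] -/
def neckLo (w u t : ℝ) : 𝔼 2 :=
  b.railLo t + (u * neckBump b.tcLo (b.epsLo / 8) t * (1 / 4 - w)) • pt2 0 1

/-- **The necked upper arch**: the height of the upper rail arch lowered by `u (1/4 - w)` times the
bump of core half-width `epsHi/8` about `tcHi`. [folklore] -/
def neckUp (w u t : ℝ) : 𝔼 2 :=
  b.railUp t - (u * neckBump b.tcHi (b.epsHi / 8) t * (1 / 4 - w)) • pt2 0 1

/-- First coordinate of the necked lower arch: that of the rail arch. [folklore] -/
@[simp] theorem neckLo_apply_zero (w u t : ℝ) : b.neckLo w u t 0 = b.railLo t 0 := by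
  simp [neckLo]

/-- Second coordinate of the necked lower arch. [folklore] -/
@[simp] theorem neckLo_apply_one (w u t : ℝ) :
    b.neckLo w u t 1 = b.railLo t 1 + u * neckBump b.tcLo (b.epsLo / 8) t * (1 / 4 - w) := by
  simp [neckLo]

/-- First coordinate of the necked upper arch: that of the rail arch. [folklore] -/
@[simp] theorem neckUp_apply_zero (w u t : ℝ) : b.neckUp w u t 0 = b.railUp t 0 := by
  simp [neckUp]

/-- Second coordinate of the necked upper arch. [folklore] -/
@[simp] theorem neckUp_apply_one (w u t : ℝ) :
    b.neckUp w u t 1 = b.railUp t 1 - u * neckBump b.tcHi (b.epsHi / 8) t * (1 / 4 - w) := by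
  simp [neckUp]

/-- At `u = 0` the necked lower arch is the rail arch. [folklore] -/
@[simp] theorem neckLo_zero (w t : ℝ) : b.neckLo w 0 t = b.railLo t := by
  simp [neckLo]

/-- At `u = 0` the necked upper arch is the rail arch. [folklore] -/
@[simp] theorem neckUp_zero (w t : ℝ) : b.neckUp w 0 t = b.railUp t := by
  simp [neckUp]

/-- The lower window `(tcLo - epsLo/4, tcLo + epsLo/4)` carries the bump; off it the necked lower
arch is the rail arch. [folklore] -/
theorem neckLo_eq_railLo {w u t : ℝ} (ht : t ∉ Ioo (b.tcLo - 2 * (b.epsLo / 8)) (b.tcLo + 2 * (b.epsLo / 8))) :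
    b.neckLo w u t = b.railLo t := by
  rw [neckLo, neckBump_eq_zero_of_not_mem (by linarith [b.epsLo_bounds.1]) ht]; simp

/-- Off the upper window the necked upper arch is the rail arch. [folklore] -/
theorem neckUp_eq_railUp {w u t : ℝ} (ht : t ∉ Ioo (b.tcHi - 2 * (b.epsHi / 8)) (b.tcHi + 2 * (b.epsHi / 8))) :
    b.neckUp w u t = b.railUp t := by
  rw [neckUp, neckBump_eq_zero_of_not_mem (by linarith [b.epsHi_bounds.1]) ht]; simp

/-- **The neck (lower core)**: for `t ∈ [tcLo - epsLo/8, tcLo + epsLo/8]` and `u = 1` the necked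
lower arch is `(χ₁ t, 1/2 - w)`. [folklore] -/
theorem neckLo_of_mem_core {w t : ℝ} (ht : t ∈ Icc (b.tcLo - b.epsLo / 8) (b.tcLo + b.epsLo / 8)) :
    b.neckLo w 1 t = pt2 (smoothStep (b.alo + b.epsLo) (b.tlo - b.epsLo) t) (1 / 2 - w) := by
  obtain ⟨h1, h2, hε⟩ := b.tcLo_window
  have hplat : t ∈ Icc (b.alo + 2 * b.epsLo) (b.tlo - 2 * b.epsLo) := ⟨by linarith [ht.1], by linarith [ht.2]⟩
  have h8 : 0 < b.epsLo / 8 := by positivity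
  rw [neckLo, b.railLo_of_mem_plateau hplat, neckBump_eq_one h8 ht]
  ext i
  fin_cases i
  · simp
  · simp
    ring

/-- **The neck (upper core)**: for `t ∈ [tcHi - epsHi/8, tcHi + epsHi/8]` and `u = 1` the necked
upper arch is `(χ t, 1/2 + w)`. [folklore] -/
theorem neckUp_of_mem_core {w t : ℝ} (ht : t ∈ Icc (b.tcHi - b.epsHi / 8) (b.tcHi + b.epsHi / 8)) :
    b.neckUp w 1 t = pt2 (smoothStep (-b.ahi + b.epsHi) (-b.thi - b.epsHi) (-t)) (1 / 2 + w) := by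
  obtain ⟨h1, h2, hε⟩ := b.tcHi_window
  have hplat : t ∈ Icc (b.thi + 2 * b.epsHi) (b.ahi - 2 * b.epsHi) := ⟨by linarith [ht.1], by linarith [ht.2]⟩
  have h8 : 0 < b.epsHi / 8 := by positivity
  rw [neckUp, b.railUp_of_mem_plateau hplat, neckBump_eq_one h8 ht]
  ext i
  fin_cases i
  · simp
  · simp
    ring

/-- At the lower crossing parameter the necked lower arch (for `u = 1`) is `(1/2, 1/2 - w)`.
[folklore] -/
theorem neckLo_tcLo (w : ℝ) : b.neckLo w 1 b.tcLo = pt2 (1 / 2) (1 / 2 - w) := by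
  have hε := b.epsLo_bounds.1
  rw [b.neckLo_of_mem_core ⟨by linarith, by linarith⟩, tcLo,
    show (b.alo + b.tlo) / 2 = (b.alo + b.epsLo + (b.tlo - b.epsLo)) / 2 by ring,
    smoothStep_midpoint (by linarith [b.cLo_hyp.2.1])]

/-- At the upper crossing parameter the necked upper arch (for `u = 1`) is `(1/2, 1/2 + w)`.
[folklore] -/
theorem neckUp_tcHi (w : ℝ) : b.neckUp w 1 b.tcHi = pt2 (1 / 2) (1 / 2 + w) := by
  have hε := b.epsHi_bounds.1
  rw [b.neckUp_of_mem_core ⟨by linarith, by linarith⟩, tcHi,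
    show -((b.thi + b.ahi) / 2) = (-b.ahi + b.epsHi + (-b.thi - b.epsHi)) / 2 by ring,
    smoothStep_midpoint (by linarith [b.cUp_hyp.2.1])]

/-- The necked lower arch is jointly `C^∞` in `(u, t)`. [folklore] -/
theorem contDiff_neckLo (w : ℝ) : ContDiff ℝ ∞ fun p : ℝ × ℝ ↦ b.neckLo w p.1 p.2 := by
  have h1 : ContDiff ℝ ∞ fun p : ℝ × ℝ ↦ b.railLo p.2 := b.contDiff_railLo.comp contDiff_snd
  have h2 : ContDiff ℝ ∞ fun p : ℝ × ℝ ↦ p.1 * neckBump b.tcLo (b.epsLo / 8) p.2 * (1 / 4 - w) :=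
    (contDiff_fst.mul ((contDiff_neckBump _ _).comp contDiff_snd)).mul contDiff_const
  show ContDiff ℝ ∞ fun p : ℝ × ℝ ↦ b.railLo p.2 + (p.1 * neckBump b.tcLo (b.epsLo / 8) p.2 * (1 / 4 - w)) • pt2 0 1
  exact h1.add (h2.smul contDiff_const)

/-- The necked upper arch is jointly `C^∞` in `(u, t)`. [folklore] -/
theorem contDiff_neckUp (w : ℝ) : ContDiff ℝ ∞ fun p : ℝ × ℝ ↦ b.neckUp w p.1 p.2 := by
  have h1 : ContDiff ℝ ∞ fun p : ℝ × ℝ ↦ b.railUp p.2 := b.contDiff_railUp.comp contDiff_snd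
  have h2 : ContDiff ℝ ∞ fun p : ℝ × ℝ ↦ p.1 * neckBump b.tcHi (b.epsHi / 8) p.2 * (1 / 4 - w) :=
    (contDiff_fst.mul ((contDiff_neckBump _ _).comp contDiff_snd)).mul contDiff_const
  show ContDiff ℝ ∞ fun p : ℝ × ℝ ↦ b.railUp p.2 - (p.1 * neckBump b.tcHi (b.epsHi / 8) p.2 * (1 / 4 - w)) • pt2 0 1
  exact h1.sub (h2.smul contDiff_const)

/-- Each stage of the necked lower arch is `C^∞`. [folklore] -/
theorem contDiff_neckLo_stage (w u : ℝ) : ContDiff ℝ ∞ (b.neckLo w u) := by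
  have h := (b.contDiff_neckLo w).comp ((contDiff_const (c := u)).prodMk (contDiff_id (E := ℝ)))
  exact h

/-- Each stage of the necked upper arch is `C^∞`. [folklore] -/
theorem contDiff_neckUp_stage (w u : ℝ) : ContDiff ℝ ∞ (b.neckUp w u) := by
  have h := (b.contDiff_neckUp w).comp ((contDiff_const (c := u)).prodMk (contDiff_id (E := ℝ)))
  exact h

/-- **Heights of the necked lower arch on the lower window** lie in `[1/4, 1/2 - w]` for
`0 ≤ u ≤ 1`, `0 < w ≤ 1/4`. [folklore] -/
theorem neckLo_one_mem {w u t : ℝ} (hw : w ≤ 1 / 4) (hu : u ∈ Icc (0 : ℝ) 1)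
    (ht : t ∈ Icc (b.tcLo - b.epsLo / 2) (b.tcLo + b.epsLo / 2)) :
    b.neckLo w u t 1 ∈ Icc (1 / 4 : ℝ) (1 / 2 - w) := by
  obtain ⟨h1, h2, hε⟩ := b.tcLo_window
  have hplat : t ∈ Icc (b.alo + 2 * b.epsLo) (b.tlo - 2 * b.epsLo) := ⟨by linarith [ht.1], by linarith [ht.2]⟩
  rw [neckLo_apply_one, b.railLo_one_of_mem_plateau hplat]
  have hB := neckBump_mem_Icc b.tcLo (b.epsLo / 8) t
  have hprod : 0 ≤ u * neckBump b.tcLo (b.epsLo / 8) t ∧ u * neckBump b.tcLo (b.epsLo / 8) t ≤ 1 :=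
    ⟨mul_nonneg hu.1 hB.1, by nlinarith [hu.2, hB.2, hu.1, hB.1]⟩
  constructor <;> nlinarith [hprod.1, hprod.2]

/-- **Heights of the necked upper arch on the upper window** lie in `[1/2 + w, 3/4]`. [folklore] -/
theorem neckUp_one_mem {w u t : ℝ} (hw : w ≤ 1 / 4) (hu : u ∈ Icc (0 : ℝ) 1)
    (ht : t ∈ Icc (b.tcHi - b.epsHi / 2) (b.tcHi + b.epsHi / 2)) :
    b.neckUp w u t 1 ∈ Icc (1 / 2 + w : ℝ) (3 / 4) := by
  obtain ⟨h1, h2, hε⟩ := b.tcHi_window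
  have hplat : t ∈ Icc (b.thi + 2 * b.epsHi) (b.ahi - 2 * b.epsHi) := ⟨by linarith [ht.1], by linarith [ht.2]⟩
  rw [neckUp_apply_one, b.railUp_one_of_mem_plateau hplat]
  have hB := neckBump_mem_Icc b.tcHi (b.epsHi / 8) t
  have hprod : 0 ≤ u * neckBump b.tcHi (b.epsHi / 8) t ∧ u * neckBump b.tcHi (b.epsHi / 8) t ≤ 1 :=
    ⟨mul_nonneg hu.1 hB.1, by nlinarith [hu.2, hB.2, hu.1, hB.1]⟩
  constructor <;> nlinarith [hprod.1, hprod.2]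

/-- On the lower window the first coordinate lies in `(0, 1)` and the point lies in the square
neighbourhood. [folklore] -/
theorem neckLo_mem {w u t : ℝ} (hw : w ≤ 1 / 4) (hw0 : 0 < w) (hu : u ∈ Icc (0 : ℝ) 1)
    (ht : t ∈ Icc (b.tcLo - b.epsLo / 2) (b.tcLo + b.epsLo / 2)) :
    b.neckLo w u t ∈ squareNhd b.δ ∧ b.neckLo w u t 0 ∈ Ioo (0 : ℝ) 1 ∧ b.neckLo w u t 1 < 2⁻¹ := by
  obtain ⟨h1, h2, hε⟩ := b.tcLo_window
  have hδ := b.δ_pos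
  have hx1 := b.neckLo_one_mem hw hu ht
  have hx0 : b.neckLo w u t 0 ∈ Ioo (0 : ℝ) 1 := by
    rw [neckLo_apply_zero]
    exact b.railLo_zero_mem_Ioo ⟨by linarith [ht.1], by linarith [ht.2]⟩
  refine ⟨?_, hx0, by linarith [hx1.2]⟩
  rw [mem_squareNhd_iff, Fin.forall_fin_two]
  exact ⟨⟨by linarith [hx0.1], by linarith [hx0.2]⟩, ⟨by linarith [hx1.1], by linarith [hx1.2]⟩⟩

/-- On the upper window the first coordinate lies in `(0, 1)` and the point lies in the square
neighbourhood. [folklore] -/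
theorem neckUp_mem {w u t : ℝ} (hw : w ≤ 1 / 4) (hw0 : 0 < w) (hu : u ∈ Icc (0 : ℝ) 1)
    (ht : t ∈ Icc (b.tcHi - b.epsHi / 2) (b.tcHi + b.epsHi / 2)) :
    b.neckUp w u t ∈ squareNhd b.δ ∧ b.neckUp w u t 0 ∈ Ioo (0 : ℝ) 1 ∧ 2⁻¹ < b.neckUp w u t 1 := by
  obtain ⟨h1, h2, hε⟩ := b.tcHi_window
  have hδ := b.δ_pos
  have hx1 := b.neckUp_one_mem hw hu ht
  have hx0 : b.neckUp w u t 0 ∈ Ioo (0 : ℝ) 1 := by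
    rw [neckUp_apply_zero]
    exact b.railUp_zero_mem_Ioo ⟨by linarith [ht.1], by linarith [ht.2]⟩
  refine ⟨?_, hx0, by linarith [hx1.1]⟩
  rw [mem_squareNhd_iff, Fin.forall_fin_two]
  exact ⟨⟨by linarith [hx0.1], by linarith [hx0.2]⟩, ⟨by linarith [hx1.1], by linarith [hx1.2]⟩⟩

/-- **The necked lower arch is injective on the lower window** (its first coordinate is strictly
increasing there). [folklore] -/
theorem injOn_neckLo (w u : ℝ) : InjOn (b.neckLo w u) (Icc (b.tcLo - b.epsLo / 2) (b.tcLo + b.epsLo / 2)) := by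
  obtain ⟨h1, h2, hε⟩ := b.tcLo_window
  intro s hs t ht hst
  have h0 : b.railLo s 0 = b.railLo t 0 := by rw [← neckLo_apply_zero, ← neckLo_apply_zero, hst]
  exact b.strictMonoOn_railLo_zero.injOn ⟨by linarith [hs.1], by linarith [hs.2]⟩
    ⟨by linarith [ht.1], by linarith [ht.2]⟩ h0

/-- **The necked upper arch is injective on the upper window.** [folklore] -/
theorem injOn_neckUp (w u : ℝ) : InjOn (b.neckUp w u) (Icc (b.tcHi - b.epsHi / 2) (b.tcHi + b.epsHi / 2)) := by
  obtain ⟨h1, h2, hε⟩ := b.tcHi_window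
  intro s hs t ht hst
  have h0 : b.railUp s 0 = b.railUp t 0 := by rw [← neckUp_apply_zero, ← neckUp_apply_zero, hst]
  exact b.strictAntiOn_railUp_zero.injOn ⟨by linarith [hs.1], by linarith [hs.2]⟩
    ⟨by linarith [ht.1], by linarith [ht.2]⟩ h0

/-- **The necked lower arch is regular on the lower window** (the derivative of its first
coordinate is positive there). [folklore] -/
theorem deriv_neckLo_ne_zero {w u t : ℝ} (ht : t ∈ Icc (b.tcLo - b.epsLo / 2) (b.tcLo + b.epsLo / 2)) :
    deriv (b.neckLo w u) t ≠ 0 := by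
  obtain ⟨h1, h2, hε⟩ := b.tcLo_window
  intro h0
  have hd : DifferentiableAt ℝ (b.neckLo w u) t := ((b.contDiff_neckLo_stage w u).differentiable (by simp)) t
  have h0' : deriv (fun s ↦ b.neckLo w u s 0) t = 0 := by
    rw [deriv_apply_eq hd 0, h0]; rfl
  have e : (fun s ↦ b.neckLo w u s 0) = fun s ↦ b.railLo s 0 := funext fun s ↦ b.neckLo_apply_zero w u s
  rw [e] at h0'
  exact (b.deriv_railLo_zero_pos ⟨by linarith [ht.1], by linarith [ht.2]⟩).ne' h0'

/-- The derivative of the first coordinate of the upper rail arch is negative strictly inside its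
window. [folklore] -/
theorem deriv_railUp_zero_neg {t : ℝ} (ht : t ∈ Ioo (b.thi + b.epsHi) (b.ahi - b.epsHi)) :
    deriv (fun s ↦ b.railUp s 0) t < 0 := by
  have e : (fun s ↦ b.railUp s 0) =
      fun s ↦ plateauArch (-b.ahi) (-b.thi) b.epsHi (-(3 / 4)) (fun v ↦ -b.fUp (-v)) (fun v ↦ -b.gUp (-v)) (-s) 0 := by
    funext s; rfl
  rw [e, deriv_comp_neg (f := fun v ↦ plateauArch (-b.ahi) (-b.thi) b.epsHi (-(3 / 4)) (fun v ↦ -b.fUp (-v))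
    (fun v ↦ -b.gUp (-v)) v 0)]
  have h := deriv_plateauArch_zero_pos (y := -(3 / 4 : ℝ)) (f := fun v ↦ -b.fUp (-v)) (g := fun v ↦ -b.gUp (-v))
    b.cUp_hyp.1 b.cUp_hyp.2.1 (θ := -t) ⟨by linarith [ht.2], by linarith [ht.1]⟩
  linarith

/-- **The necked upper arch is regular on the upper window.** [folklore] -/
theorem deriv_neckUp_ne_zero {w u t : ℝ} (ht : t ∈ Icc (b.tcHi - b.epsHi / 2) (b.tcHi + b.epsHi / 2)) :
    deriv (b.neckUp w u) t ≠ 0 := by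
  obtain ⟨h1, h2, hε⟩ := b.tcHi_window
  intro h0
  have hd : DifferentiableAt ℝ (b.neckUp w u) t := ((b.contDiff_neckUp_stage w u).differentiable (by simp)) t
  have h0' : deriv (fun s ↦ b.neckUp w u s 0) t = 0 := by
    rw [deriv_apply_eq hd 0, h0]; rfl
  have e : (fun s ↦ b.neckUp w u s 0) = fun s ↦ b.railUp s 0 := funext fun s ↦ b.neckUp_apply_zero w u s
  rw [e] at h0'
  exact (b.deriv_railUp_zero_neg ⟨by linarith [ht.1], by linarith [ht.2]⟩).ne h0'

/-! ### The necked piece function and loop -/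

/-- The necked piece function: the rail piece function with the necked arches. [folklore] -/
def neckPiece (w u t : ℝ) : 𝔼 4 :=
  if t < b.tlo then ((b.band (b.neckLo w u t) : 𝕊 3) : 𝔼 4)
  else if t < b.thi then Knot.curve B (b.psi t)
  else if t < b.ahi then ((b.band (b.neckUp w u t) : 𝕊 3) : 𝔼 4)
  else Knot.curve A t

/-- Values of the necked piece function on the lower arch window. [folklore] -/
theorem neckPiece_of_lt_tlo {w u t : ℝ} (ht : t < b.tlo) :
    b.neckPiece w u t = ((b.band (b.neckLo w u t) : 𝕊 3) : 𝔼 4) := by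
  simp [neckPiece, ht]

/-- Values of the necked piece function on the `B`-stretch. [folklore] -/
theorem neckPiece_of_tlo_le {w u t : ℝ} (h1 : b.tlo ≤ t) (h2 : t < b.thi) :
    b.neckPiece w u t = Knot.curve B (b.psi t) := by
  simp [neckPiece, not_lt.2 h1, h2]

/-- Values of the necked piece function on the upper arch window. [folklore] -/
theorem neckPiece_of_thi_le {w u t : ℝ} (h1 : b.thi ≤ t) (h2 : t < b.ahi) :
    b.neckPiece w u t = ((b.band (b.neckUp w u t) : 𝕊 3) : 𝔼 4) := by
  have h0 : ¬ t < b.tlo := not_lt.2 (b.marks_lt.2.2.2.1.le.trans h1)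
  simp [neckPiece, h0, not_lt.2 h1, h2]

/-- Values of the necked piece function on the `A`-stretch. [folklore] -/
theorem neckPiece_of_ahi_le {w u t : ℝ} (h1 : b.ahi ≤ t) : b.neckPiece w u t = Knot.curve A t := by
  have hm := b.marks_lt
  have h0 : ¬ t < b.tlo := not_lt.2 (by linarith)
  have h0' : ¬ t < b.thi := not_lt.2 (by linarith)
  simp [neckPiece, h0, h0', not_lt.2 h1]

/-- The modification set: the two closed windows of half-width `epsLo/2`, `epsHi/2` about the
crossing parameters. [folklore] -/
def neckSet : Set ℝ :=
  Icc (b.tcLo - b.epsLo / 2) (b.tcLo + b.epsLo / 2) ∪ Icc (b.tcHi - b.epsHi / 2) (b.tcHi + b.epsHi / 2)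

/-- The modification set is closed. [folklore] -/
theorem isClosed_neckSet : IsClosed b.neckSet := isClosed_Icc.union isClosed_Icc

/-- The two windows sit inside the fundamental domain, away from the seam and from each other:
numerical consequences of the marks. [folklore] -/
theorem neckSet_bounds : b.alo + b.seamEps ≤ b.tcLo - b.epsLo / 2 ∧ b.tcLo + b.epsLo / 2 < b.tlo - b.epsLo ∧
    b.thi + b.epsHi < b.tcHi - b.epsHi / 2 ∧ b.tcHi + b.epsHi / 2 ≤ b.alo + 1 - b.seamEps := by
  obtain ⟨h1, h2, hε⟩ := b.tcLo_window
  obtain ⟨h3, h4, hε'⟩ := b.tcHi_window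
  obtain ⟨hs0, hs1, hs2, hs3⟩ := b.seamEps_bounds
  refine ⟨by linarith, by linarith, by linarith, by linarith⟩

/-- The modification set lies in `[alo + seamEps, alo + 1 - seamEps]`. [folklore] -/
theorem neckSet_subset : b.neckSet ⊆ Icc (b.alo + b.seamEps) (b.alo + 1 - b.seamEps) := by
  obtain ⟨h1, h2, h3, h4⟩ := b.neckSet_bounds
  have hm := b.marks_lt
  obtain ⟨hε, -, -⟩ := b.epsLo_bounds
  obtain ⟨hε', -, -⟩ := b.epsHi_bounds
  rintro t (ht | ht)
  · exact ⟨by linarith [ht.1], by linarith [ht.2]⟩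
  · exact ⟨by linarith [ht.1], by linarith [ht.2]⟩

/-- **Off the modification set the necked piece function is the rail piece function.** [folklore] -/
theorem neckPiece_eq_railPiece {w u t : ℝ} (ht : t ∉ b.neckSet) : b.neckPiece w u t = b.railPiece t := by
  obtain ⟨h1, h2, hε⟩ := b.tcLo_window
  obtain ⟨h3, h4, hε'⟩ := b.tcHi_window
  simp only [neckSet, mem_union, not_or] at ht
  have hlo : b.neckLo w u t = b.railLo t := b.neckLo_eq_railLo (fun h ↦ ht.1 ⟨by linarith [h.1], by linarith [h.2]⟩)
  have hhi : b.neckUp w u t = b.railUp t := b.neckUp_eq_railUp (fun h ↦ ht.2 ⟨by linarith [h.1], by linarith [h.2]⟩)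
  simp only [neckPiece, railPiece, hlo, hhi]

/-- At `u = 0` the necked piece function is the rail piece function. [folklore] -/
theorem neckPiece_zero (w t : ℝ) : b.neckPiece w 0 t = b.railPiece t := by
  simp only [neckPiece, railPiece, neckLo_zero, neckUp_zero]

/-- **The necked piece function is jointly `C^∞` in `(u, t)`** (same four overlapping pieces as the
rail piece function). [folklore] -/
theorem contDiff_neckPiece (w : ℝ) : ContDiff ℝ ∞ (uncurry (b.neckPiece w)) := by
  have hm := b.marks_lt
  obtain ⟨hε, hε1, -⟩ := b.epsLo_bounds
  obtain ⟨hε', hε1', -⟩ := b.epsHi_bounds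
  obtain ⟨h1, h2, -⟩ := b.tcLo_window
  obtain ⟨h3, h4, -⟩ := b.tcHi_window
  have hLo : ContDiff ℝ ∞ fun p : ℝ × ℝ ↦ ((b.band (b.neckLo w p.1 p.2) : 𝕊 3) : 𝔼 4) :=
    b.contDiff_coe_band.comp (b.contDiff_neckLo w)
  have hUp : ContDiff ℝ ∞ fun p : ℝ × ℝ ↦ ((b.band (b.neckUp w p.1 p.2) : 𝕊 3) : 𝔼 4) :=
    b.contDiff_coe_band.comp (b.contDiff_neckUp w)
  have hBp : ContDiff ℝ ∞ fun p : ℝ × ℝ ↦ Knot.curve B (b.psi p.2) :=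
    ((Knot.contDiff_curve B).comp b.contDiff_psi).comp contDiff_snd
  have hAp : ContDiff ℝ ∞ fun p : ℝ × ℝ ↦ Knot.curve A p.2 := (Knot.contDiff_curve A).comp contDiff_snd
  rw [contDiff_iff_contDiffAt]
  rintro ⟨u, t⟩
  rcases lt_or_ge t b.tlo with ht1 | ht1
  · refine hLo.contDiffAt.congr_of_eventuallyEq ?_
    filter_upwards [prod_mem_nhds univ_mem (Iio_mem_nhds ht1)] with p hp using b.neckPiece_of_lt_tlo hp.2
  rcases lt_or_ge t (b.thi + b.epsHi) with ht2 | ht2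
  · refine hBp.contDiffAt.congr_of_eventuallyEq ?_
    filter_upwards [prod_mem_nhds univ_mem (isOpen_Ioo.mem_nhds (show t ∈ Ioo (b.tlo - b.epsLo) (b.thi + b.epsHi)
      from ⟨by linarith, ht2⟩))] with p hp
    have hnot : p.2 ∉ b.neckSet := by
      rintro (h | h) <;> [linarith [h.2, hp.2.1]; linarith [h.1, hp.2.2]]
    rw [uncurry_apply_pair] at *
    show b.neckPiece w p.1 p.2 = Knot.curve B (b.psi p.2)
    rw [b.neckPiece_eq_railPiece hnot]
    rcases lt_or_ge p.2 b.tlo with h | h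
    · exact b.railPiece_eq_B ⟨hp.2.1, by linarith⟩
    · exact b.railPiece_eq_B' ⟨h, hp.2.2⟩
  rcases lt_or_ge t b.ahi with ht3 | ht3
  · refine hUp.contDiffAt.congr_of_eventuallyEq ?_
    filter_upwards [prod_mem_nhds univ_mem (isOpen_Ioo.mem_nhds (show t ∈ Ioo b.thi b.ahi from ⟨by linarith, ht3⟩))]
      with p hp using b.neckPiece_of_thi_le hp.2.1.le hp.2.2
  · refine hAp.contDiffAt.congr_of_eventuallyEq ?_
    filter_upwards [prod_mem_nhds univ_mem (Ioi_mem_nhds (show b.ahi - b.epsHi < t by linarith))] with p hp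
    have hp2 : b.ahi - b.epsHi < p.2 := hp.2
    have hnot : p.2 ∉ b.neckSet := by
      rintro (h | h)
      · linarith [h.2]
      · linarith [h.2]
    show b.neckPiece w p.1 p.2 = Knot.curve A p.2
    rw [b.neckPiece_eq_railPiece hnot]
    rcases lt_or_ge p.2 (b.alo + 1) with h | h
    · exact b.railPiece_eq_A ⟨hp.2, h⟩
    · exact b.railPiece_of_ahi_le (by linarith)

/-- **The necked loop** `periodise alo (neckPiece w u)`. [folklore] -/
def neckLoop (w u : ℝ) : ℝ → 𝔼 4 := periodise b.alo (b.neckPiece w u)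

/-- The necked piece function takes values on the unit sphere on the modification set. [folklore] -/
theorem norm_neckPiece (w u t : ℝ) : ‖b.neckPiece w u t‖ = 1 := by
  rw [neckPiece]
  split_ifs
  · exact norm_eq_of_mem_sphere _
  · exact Knot.norm_curve B _
  · exact norm_eq_of_mem_sphere _
  · exact Knot.norm_curve A _

/-- On the lower window the necked piece function is `band ∘ neckLo`. [folklore] -/
theorem neckPiece_of_mem_lower {w u t : ℝ} (ht : t ∈ Icc (b.tcLo - b.epsLo / 2) (b.tcLo + b.epsLo / 2)) :
    b.neckPiece w u t = ((b.band (b.neckLo w u t) : 𝕊 3) : 𝔼 4) :=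
  b.neckPiece_of_lt_tlo (by linarith [ht.2, b.neckSet_bounds.2.1, b.epsLo_bounds.1])

/-- On the upper window the necked piece function is `band ∘ neckUp`. [folklore] -/
theorem neckPiece_of_mem_upper {w u t : ℝ} (ht : t ∈ Icc (b.tcHi - b.epsHi / 2) (b.tcHi + b.epsHi / 2)) :
    b.neckPiece w u t = ((b.band (b.neckUp w u t) : 𝕊 3) : 𝔼 4) :=
  b.neckPiece_of_thi_le (by linarith [ht.1, b.neckSet_bounds.2.2.1, b.epsHi_bounds.1])
    (by linarith [ht.2, b.tcHi_window.2.1, b.epsHi_bounds.1])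

/-- **Regularity of the necked piece function on the modification set.** [folklore] -/
theorem deriv_neckPiece_ne_zero {w u : ℝ} (hw : w ≤ 1 / 4) (hw0 : 0 < w) (hu : u ∈ Icc (0 : ℝ) 1) {t : ℝ}
    (ht : t ∈ b.neckSet) : deriv (b.neckPiece w u) t ≠ 0 := by
  obtain ⟨h1, h2, h3, h4⟩ := b.neckSet_bounds
  have hm := b.marks_lt
  obtain ⟨hε, -, -⟩ := b.epsLo_bounds
  obtain ⟨hε', -, -⟩ := b.epsHi_bounds
  rcases ht with ht | ht
  · have hev : b.neckPiece w u =ᶠ[𝓝 t] fun s ↦ ((b.band (b.neckLo w u s) : 𝕊 3) : 𝔼 4) := by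
      filter_upwards [Iio_mem_nhds (show t < b.tlo by linarith [ht.2])] with s hs using b.neckPiece_of_lt_tlo hs
    rw [hev.deriv_eq]
    exact b.deriv_coe_band_comp_ne_zero (((b.contDiff_neckLo_stage w u).differentiable (by simp)) _)
      (b.neckLo_mem hw hw0 hu ht).1 (b.deriv_neckLo_ne_zero ht)
  · have hev : b.neckPiece w u =ᶠ[𝓝 t] fun s ↦ ((b.band (b.neckUp w u s) : 𝕊 3) : 𝔼 4) := by
      filter_upwards [isOpen_Ioo.mem_nhds (show t ∈ Ioo b.thi b.ahi from ⟨by linarith [ht.1], by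
        linarith [ht.2, b.tcHi_window.2.1]⟩)] with s hs using b.neckPiece_of_thi_le hs.1.le hs.2
    rw [hev.deriv_eq]
    exact b.deriv_coe_band_comp_ne_zero (((b.contDiff_neckUp_stage w u).differentiable (by simp)) _)
      (b.neckUp_mem hw hw0 hu ht).1 (b.deriv_neckUp_ne_zero ht)

/-- **Injectivity of the necked piece function on the modification set.** [folklore] -/
theorem injOn_neckPiece {w u : ℝ} (hw : w ≤ 1 / 4) (hw0 : 0 < w) (hu : u ∈ Icc (0 : ℝ) 1) :
    InjOn (b.neckPiece w u) b.neckSet := by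
  rintro s (hs | hs) t (ht | ht) hst
  · rw [b.neckPiece_of_mem_lower hs, b.neckPiece_of_mem_lower ht] at hst
    exact b.injOn_neckLo w u hs ht (b.injOn (b.neckLo_mem hw hw0 hu hs).1 (b.neckLo_mem hw hw0 hu ht).1 (Subtype.ext hst))
  · rw [b.neckPiece_of_mem_lower hs, b.neckPiece_of_mem_upper ht] at hst
    have := congrArg (fun x : 𝔼 2 ↦ x 1)
      (b.injOn (b.neckLo_mem hw hw0 hu hs).1 (b.neckUp_mem hw hw0 hu ht).1 (Subtype.ext hst))
    simp only at this
    linarith [(b.neckLo_mem hw hw0 hu hs).2.2, (b.neckUp_mem hw hw0 hu ht).2.2]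
  · rw [b.neckPiece_of_mem_upper hs, b.neckPiece_of_mem_lower ht] at hst
    have := congrArg (fun x : 𝔼 2 ↦ x 1)
      (b.injOn (b.neckUp_mem hw hw0 hu hs).1 (b.neckLo_mem hw hw0 hu ht).1 (Subtype.ext hst))
    simp only at this
    linarith [(b.neckUp_mem hw hw0 hu hs).2.2, (b.neckLo_mem hw hw0 hu ht).2.2]
  · rw [b.neckPiece_of_mem_upper hs, b.neckPiece_of_mem_upper ht] at hst
    exact b.injOn_neckUp w u hs ht (b.injOn (b.neckUp_mem hw hw0 hu hs).1 (b.neckUp_mem hw hw0 hu ht).1 (Subtype.ext hst))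

/-- **The necked pieces avoid the rest of the rail knot.** [folklore] -/
theorem neckPiece_ne_railPiece {w u : ℝ} (hw : w ≤ 1 / 4) (hw0 : 0 < w)
    (hu : u ∈ Icc (0 : ℝ) 1) {s : ℝ} (hs : s ∈ b.neckSet) {t : ℝ} (ht : t ∈ Ico b.alo (b.alo + 1))
    (hts : t ∉ b.neckSet) : b.neckPiece w u s ≠ b.railPiece t := by
  obtain ⟨h1, h2, h3, h4⟩ := b.neckSet_bounds
  obtain ⟨h1', h2', -⟩ := b.tcLo_window
  obtain ⟨h3', h4', -⟩ := b.tcHi_window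
  have hm := b.marks_lt
  obtain ⟨hε, -, -⟩ := b.epsLo_bounds
  obtain ⟨hε', -, -⟩ := b.epsHi_bounds
  -- the new point: a band point strictly inside the square, below or above the middle height
  obtain ⟨p, hpeq, hpU, hp0, hp1⟩ : ∃ p : 𝔼 2, b.neckPiece w u s = ((b.band p : 𝕊 3) : 𝔼 4) ∧ p ∈ squareNhd b.δ ∧
      p 0 ∈ Ioo (0 : ℝ) 1 ∧ (p 1 < 2⁻¹ ∧ p 0 = b.railLo s 0 ∧ s ∈ Icc (b.tcLo - b.epsLo / 2) (b.tcLo + b.epsLo / 2) ∨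
        2⁻¹ < p 1 ∧ p 0 = b.railUp s 0 ∧ s ∈ Icc (b.tcHi - b.epsHi / 2) (b.tcHi + b.epsHi / 2)) := by
    rcases hs with hs | hs
    · exact ⟨_, b.neckPiece_of_mem_lower hs, (b.neckLo_mem hw hw0 hu hs).1, (b.neckLo_mem hw hw0 hu hs).2.1,
        Or.inl ⟨(b.neckLo_mem hw hw0 hu hs).2.2, b.neckLo_apply_zero w u s, hs⟩⟩
    · exact ⟨_, b.neckPiece_of_mem_upper hs, (b.neckUp_mem hw hw0 hu hs).1, (b.neckUp_mem hw hw0 hu hs).2.1,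
        Or.inr ⟨(b.neckUp_mem hw hw0 hu hs).2.2, b.neckUp_apply_zero w u s, hs⟩⟩
  rw [hpeq]
  intro hst
  rcases b.kind_cases t with hkt | hkt | hkt | hkt
  · -- `t` of type A
    rw [b.railPiece_typeA ht hkt, Knot.curve_apply] at hst
    exact b.band_not_mem_range_A hpU hp0.1.ne' ⟨_, Subtype.ext hst.symm⟩
  · -- `t` of type B
    rw [b.railPiece_typeB hkt, Knot.curve_apply] at hst
    exact b.band_not_mem_range_B hpU hp0.2.ne ⟨_, Subtype.ext hst.symm⟩
  · -- `t` in the lower arch region: `railPiece t = band (railLo t)`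
    obtain ⟨he, hU, h0, h1', -, -⟩ := b.railPiece_typeO_lo hkt
    rw [he] at hst
    have hpt : p = b.railLo t := b.injOn hpU hU (Subtype.ext hst)
    rcases hp1 with ⟨-, hx0, hsw⟩ | ⟨hgt, -, -⟩
    · -- same window type: first coordinates (strictly monotone) force `s = t`, contradiction
      have e0 : b.railLo s 0 = b.railLo t 0 := by rw [← hx0, hpt]
      have hst' : s = t := b.strictMonoOn_railLo_zero.injOn ⟨by linarith [hsw.1], by linarith [hsw.2]⟩
        ⟨hkt.1.le, hkt.2.le⟩ e0
      exact hts (hst' ▸ Or.inl hsw)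
    · -- heights differ
      have := (b.railLo_mem (t := t) ⟨by linarith [hkt.1], by linarith [hkt.2]⟩).2
      rw [hpt] at hgt
      linarith [this.2]
  · -- `t` in the upper arch region
    obtain ⟨he, hU, h0, h1', -, -⟩ := b.railPiece_typeO_hi hkt
    rw [he] at hst
    have hpt : p = b.railUp t := b.injOn hpU hU (Subtype.ext hst)
    rcases hp1 with ⟨hlt, -, -⟩ | ⟨-, hx0, hsw⟩
    · have := (b.railUp_mem (t := t) ⟨by linarith [hkt.1], by linarith [hkt.2]⟩).2
      rw [hpt] at hlt
      linarith [this.1]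
    · have e0 : b.railUp s 0 = b.railUp t 0 := by rw [← hx0, hpt]
      have hst' : s = t := b.strictAntiOn_railUp_zero.injOn ⟨by linarith [hsw.1], by linarith [hsw.2]⟩
        ⟨hkt.1.le, hkt.2.le⟩ e0
      exact hts (hst' ▸ Or.inr hsw)

/-- **The necked loop (for `u ∈ [0, 1]`) is a regular loop.** [folklore] -/
theorem isRegularLoop_neckLoop {w u : ℝ} (hw : w ≤ 1 / 4) (hw0 : 0 < w) (hu : u ∈ Icc (0 : ℝ) 1) :
    IsRegularLoop (b.neckLoop w u) :=
  b.isRegularLoop_railLoop.periodise_of_eqOn_compl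
    (show ContDiff ℝ ∞ (b.neckPiece w u) from
      (b.contDiff_neckPiece w).comp ((contDiff_const (c := u)).prodMk (contDiff_id (E := ℝ))))
    b.seamEps_bounds.1 b.railPiece_seam b.neckSet_subset b.isClosed_neckSet (fun _ ht ↦ b.neckPiece_eq_railPiece ht)
    (fun t _ ↦ b.norm_neckPiece w u t) (fun _ ht ↦ b.deriv_neckPiece_ne_zero hw hw0 hu ht)

/-- **The necked piece function (for `u ∈ [0, 1]`) is injective on the fundamental domain.**
[folklore] -/
theorem injOn_neckPiece_Ico (hAB : Disjoint (range A) (range B)) {w u : ℝ} (hw : w ≤ 1 / 4) (hw0 : 0 < w)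
    (hu : u ∈ Icc (0 : ℝ) 1) : InjOn (b.neckPiece w u) (Ico b.alo (b.alo + 1)) :=
  injOn_Ico_of_eqOn_compl (b.injOn_railPiece hAB) (fun _ ht ↦ b.neckPiece_eq_railPiece ht)
    (b.injOn_neckPiece hw hw0 hu) (fun _ hs _ ht hts ↦ b.neckPiece_ne_railPiece hw hw0 hu hs ht hts)

/-- **The necked rail knot** with neck half-width `w ∈ (0, 1/4]`: the knot of the necked loop at
`u = 1`. [folklore] -/
def neckKnot {w : ℝ} (hw : w ≤ 1 / 4) (hw0 : 0 < w) (hAB : Disjoint (range A) (range B)) : Knot :=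
  (b.isRegularLoop_neckLoop hw hw0 ⟨zero_le_one, le_rfl⟩).toKnot
    (periodise_simple_iff.2 (b.injOn_neckPiece_Ico hAB hw hw0 ⟨zero_le_one, le_rfl⟩))

/-- The necked rail knot through the parameter `circlePt t` is `neckLoop w 1 t` in `ℝ⁴`. [folklore] -/
theorem coe_neckKnot_circlePt {w : ℝ} (hw : w ≤ 1 / 4) (hw0 : 0 < w) (hAB : Disjoint (range A) (range B)) (t : ℝ) :
    ((b.neckKnot hw hw0 hAB (circlePt t) : 𝕊 3) : 𝔼 4) = b.neckLoop w 1 t :=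
  (b.isRegularLoop_neckLoop hw hw0 ⟨zero_le_one, le_rfl⟩).coe_toKnot_circlePt _ t

/-- **The rail knot is isotopic to the necked rail knot** (a smooth family of modifications of the
rail loop on the two windows; isotopy extension). [cite: HirschDT1976, Ch. 8 §1, Thm. 1.3] -/
theorem isIsotopic_railKnot_neckKnot {w : ℝ} (hw : w ≤ 1 / 4) (hw0 : 0 < w) (hAB : Disjoint (range A) (range B)) :
    (b.railKnot hAB).IsIsotopic (b.neckKnot hw hw0 hAB) :=
  IsRegularLoop.isIsotopic_of_modification (G := b.neckPiece w) b.isRegularLoop_railLoop (b.injOn_railPiece hAB)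
    (b.isRegularLoop_neckLoop hw hw0 ⟨zero_le_one, le_rfl⟩) (b.injOn_neckPiece_Ico hAB hw hw0 ⟨zero_le_one, le_rfl⟩)
    b.seamEps_bounds.1 b.railPiece_seam (b.contDiff_neckPiece w) b.neckSet_subset b.isClosed_neckSet
    (fun _ _ ht ↦ b.neckPiece_eq_railPiece ht) (b.neckPiece_zero w) (fun u _ t _ ↦ b.norm_neckPiece w u t)
    (fun _ hu _ ht ↦ b.deriv_neckPiece_ne_zero hw hw0 hu ht) (fun _ hu ↦ b.injOn_neckPiece hw hw0 hu)
    (fun _ hu _ hs _ ht hts ↦ b.neckPiece_ne_railPiece hw hw0 hu hs ht hts)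

end BandData

end Literature.Topology.FourManifolds
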